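import Summits.HodgeConjecture.HodgeCM.Model.ThetaHolAssembly_1

/-! PORT of `HodgeCM/Model/ThetaHolAssembly.lean` (HodgeCMPerL run 82) — part 2: continuation of `Summits.HodgeConjecture.HodgeCM.Model.ThetaHolAssembly_1` (split at a top-level declaration boundary by port_pkg.py; scope re-opened below; declarations unchanged). -/

-- port_pkg: scope re-opened for this part (file-level context, then the namespace/section stack open at the cut)
set_option autoImplicit false
noncomputable section
open Filter Topology
open scoped Classical SchwartzMap
open MulAction NumberField.mixedEmbedding
open Literature.Geometry.ComplexHyperbolic.BallModel (U21 Ball x₀)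
open Literature.NumberTheory.Automorphic Literature.NumberTheory.Weil1964
open Literature.NumberTheory.Automorphic.WeightForms (ClassMapDatum thetaClasses restrictHom IsLevelCorrected
  IsWeightMatched)
open Literature.AlgebraicGeometry.HodgeTheory
open Literature.AlgebraicGeometry.ShimuraVarieties
open Literature.NumberTheory.Automorphic.PicardCM
open HodgeCM.PerL34.Seesaw HodgeCM.PerL34.RationalCoset HodgeCM.PerL34.SupplyAdelic
open HodgeCM.Model.SupplyInstance HodgeCM.Model.SupplyResidual
open HodgeCM.Model.ThetaSpace
namespace HodgeCM
namespace Model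
section EndState
variable (hHD : exists_isReal_hodgeModel) (hI : hodgePQ_independent_of_hodgeModel)
  (h₁ : BallQuotientUniformised)  (h₃ : CMAbelianVarietyRealised)
/-- **E's `classPacks` over the END STATE from the adelic side `S`, the archimedean `K`-type data `C`, and
the three one-sided hypotheses (H1) `hT`, (AN) `hd`, (REP) `hk`** — `classPacksOf_pin` with its binder `hol`
ASSEMBLED (`ArchKTypeData.hol_of_isPMinusKilled`). -/
theorem classPacksOf_pin_of_isPMinusKilled (h : Bool)
    (emb : ∀ {L : CMField} {ι₁ : L →+* ℂ} {V : HermSpace3 L ι₁} (Γ : Level V),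
      (picardCMUniverse hHD hI h₁ h₃).CohC ((picardCMUniverse hHD hI h₁ h₃).pms L ι₁ V Γ) 2 →ₗ[ℂ]
        (V.latticeModel printFact_unitaryCompact_holds).toQuotientModel.H)
    (cover : ∀ {L : CMField} {ι₁ : L →+* ℂ} {V : HermSpace3 L ι₁} (Γ Γ' : Level V),
      Γ'.Γ ≤ Γ.Γ → (picardCMUniverse hHD hI h₁ h₃).Mor ((picardCMUniverse hHD hI h₁ h₃).pms L ι₁ V Γ')
        ((picardCMUniverse hHD hI h₁ h₃).pms L ι₁ V Γ))
    (wm : ∀ {L : CMField} {ι₁ : L →+* ℂ} (V : HermSpace3 L ι₁) (c : SeesawCtx L),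
      WeilThetaModel (V.latticeModel printFact_unitaryCompact_holds).toQuotientModel.G
        (V.latticeModel printFact_unitaryCompact_holds).toQuotientModel.Γ
        (c.D.latticeModelW printFact_unitaryCompact_holds).toQuotientModel.G
        (c.D.latticeModelW printFact_unitaryCompact_holds).toQuotientModel.Γ)
    (S : ∀ {L : CMField} {ι₁ : L →+* ℂ} (V : HermSpace3 L ι₁) (c : SeesawCtx L), ThetaAdelicSide V c)
    (d12 d34 : ∀ {L : CMField}, SeesawCtx L → HodgeCM.Universe.SideData L)
    (C : ∀ {L : CMField} {ι₁ : L →+* ℂ} (V : HermSpace3 L ι₁) (c : SeesawCtx L) (hV : IsAnisotropic L V.Hm),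
      (thetaModelOf hHD hI h₁ h₃ h emb cover wm
        (thetaOf _ (thetaClassInputOf _ (fun V c => thetaSpaceInputOf hHD hI h₁ h₃ S V c))) d12 d34).GoodCtx
          ι₁ c →
      Module.finrank ℚ c.K = 6 → ∀ k : Fin 4, k = 0 ∨ k = 1 → ∀ N : ℕ, 0 < N →
        ArchKTypeData (thetaSpaceInputIn hHD hI h₁ h₃ (S V c) hV) k N)
    (hT : ∀ {L : CMField} {ι₁ : L →+* ℂ} (V : HermSpace3 L ι₁) (c : SeesawCtx L) (k : Fin 4) (N : ℕ),
      ((S V c).P k).IsThetaArchContinuous N)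
    (hd : ∀ {L : CMField} {ι₁ : L →+* ℂ} (V : HermSpace3 L ι₁) (c : SeesawCtx L) (hV : IsAnisotropic L V.Hm)
      (hc : (thetaModelOf hHD hI h₁ h₃ h emb cover wm
        (thetaOf _ (thetaClassInputOf _ (fun V c => thetaSpaceInputOf hHD hI h₁ h₃ S V c))) d12 d34).GoodCtx
          ι₁ c)
      (h6 : Module.finrank ℚ c.K = 6) (k : Fin 4) (hk : k = 0 ∨ k = 1) (N : ℕ) (hN : 0 < N),
      (C V c hV hc h6 k hk N hN).IsWeaklyPDiff BallForms.expP)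
    (hk : ∀ {L : CMField} {ι₁ : L →+* ℂ} (V : HermSpace3 L ι₁) (c : SeesawCtx L) (hV : IsAnisotropic L V.Hm)
      (hc : (thetaModelOf hHD hI h₁ h₃ h emb cover wm
        (thetaOf _ (thetaClassInputOf _ (fun V c => thetaSpaceInputOf hHD hI h₁ h₃ S V c))) d12 d34).GoodCtx
          ι₁ c)
      (h6 : Module.finrank ℚ c.K = 6) (k : Fin 4) (hk : k = 0 ∨ k = 1) (N : ℕ) (hN : 0 < N),
      (C V c hV hc h6 k hk N hN).IsPMinusKilled BallForms.expP)
    {L : CMField} {ι₁ : L →+* ℂ} (V : HermSpace3 L ι₁) (c : SeesawCtx L)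
    (hc : (thetaModelOf hHD hI h₁ h₃ h emb cover wm
      (thetaOf _ (thetaClassInputOf _ (fun V c => thetaSpaceInputOf hHD hI h₁ h₃ S V c))) d12 d34).GoodCtx
        ι₁ c)
    (h6 : Module.finrank ℚ c.K = 6) :
    Nonempty (ClassSupplyPackN (thetaModelOf hHD hI h₁ h₃ h emb cover wm
        (thetaOf _ (thetaClassInputOf _ (fun V c => thetaSpaceInputOf hHD hI h₁ h₃ S V c))) d12 d34) V c 0) ∧
      Nonempty (ClassSupplyPackN (thetaModelOf hHD hI h₁ h₃ h emb cover wm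
        (thetaOf _ (thetaClassInputOf _ (fun V c => thetaSpaceInputOf hHD hI h₁ h₃ S V c))) d12 d34) V c 1) :=
  classPacksOf_pin hHD hI h₁ h₃ h emb cover wm S d12 d34 C
    (fun V c hV hc h6 k hk' N hN =>
      (C V c hV hc h6 k hk' N hN).hol_of_isPMinusKilled hHD hI h₁ h₃ (S V c) hV (hT V c k N)
        (hd V c hV hc h6 k hk' N hN) (hk V c hV hc h6 k hk' N hN))
    V c hc h6

end EndState

end Model
end HodgeCM

end
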